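import Mathlib
import Literature.Probability.LatticeModels.LatticeGraph

/-!
# Cube representations from dual-cone inequalities: the finite-family (separation) step

Pure finite-dimensional convex analysis, used by line `Sketch` of the crux `CriticalTwoPointGSM`
(stmt-CriticalPhenomena-8365). A CUBE REPRESENTATION of a kernel `G : ℤ³ → ℝ` is a probability
measure `μ` on `ℝ³` carried by the closed cube `[0,1]³` with `G x = ∫ ∏ᵢ tᵢ^{xᵢ²} dμ(t)`
(natural-number powers, `0⁰ = 1`), i.e. membership of `G` in the closed Gaussian-scale-mixture
cone. The DUAL-CONE inequalities for `G` say: whenever a finite combination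
`∑ₖ cₖ ∏ᵢ tᵢ^{x_{k,i}²}` of the polynomial kernels is non-negative on the cube, the same
combination `∑ₖ cₖ G(xₖ)` of the values of `G` is non-negative.

Main result `cubeRepApprox_of_dualCone`: if `G 0 = 1` and `G` satisfies the dual-cone
inequalities, then for every finite family of sites `x₁, …, xₘ` and every `ε > 0` there is a
probability measure on `ℝ³` carried by the closed cube whose kernel moments match `G` on the
family up to `ε` (a finite convex combination of Dirac masses at points of the cube). The
companion compactness step `cubeRep_of_cubeRepApprox` (separate file) then produces an honest cube
representation, whence "cube representation ⇔ dual-cone inequalities".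

Proof. In `V = ℝ^m` (sup norm) put `Φ(t) = (∏ᵢ tᵢ^{x_{k,i}²})ₖ` for `t` in the cube `K` and
`g = (G xₖ)ₖ`. If `g ∉ closure (convexHull (Φ '' K))`, Minkowski separation in the
finite-dimensional space `V` (`geometric_hahn_banach_point_closed`) gives a functional
`f = ∑ₖ cₖ (·)ₖ` (`LinearMap.pi_apply_eq_sum_univ`) and a level `u` with
`∑ cₖ G(xₖ) < u < ∑ cₖ Φ(t)ₖ` for all `t ∈ K`; adjoining the site `0` (kernel `∏ tᵢ⁰ ≡ 1`, value
`G 0 = 1`) with coefficient `-u` yields a combination positive on the cube and negative on `G`,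
contradicting the dual-cone hypothesis. Hence `g` is in the closed convex hull: some point
`p = ∑ⱼ wⱼ Φ(zⱼ)` of the convex hull (`mem_convexHull_iff_exists_fintype`) is `ε`-close to `g` in
the sup norm (`dist_le_pi_dist`), and the discrete probability measure `μ = ∑ⱼ wⱼ δ_{zⱼ}` has
`∫ ∏ᵢ tᵢ^{x_{k,i}²} dμ = pₖ` (`integral_finsetSum_measure`, `integral_dirac`).
-/

namespace Summit.CriticalPhenomena.Ising3DConformalLimit.Theorems

open MeasureTheory Filter Topology
open Literature.Probability.LatticeModels
open scoped BigOperators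

namespace CriticalTwoPointGSMDualCone

/-- A continuous linear functional on `ℝ^ι` (`ι` finite) is `v ↦ ∑ₖ cₖ vₖ` with `cₖ = f(eₖ)`
(`LinearMap.pi_apply_eq_sum_univ`). [folklore] -/
theorem exists_coeffs {ι : Type*} [Fintype ι] (f : StrongDual ℝ (ι → ℝ)) :
    ∃ c : ι → ℝ, ∀ v, f v = ∑ k, c k * v k := by
  classical
  refine ⟨fun k => f (fun j => if k = j then 1 else 0), fun v => ?_⟩
  have key := LinearMap.pi_apply_eq_sum_univ (f : (ι → ℝ) →ₗ[ℝ] ℝ) v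
  simp only [ContinuousLinearMap.coe_coe, smul_eq_mul] at key
  rw [key]
  exact Finset.sum_congr rfl fun k _ => mul_comm _ _

/-- Finite-dimensional separation, dual form: a point `g ∈ ℝ^ι` lies in the closed convex hull of
`S` as soon as every strict affine inequality `u < ∑ₖ cₖ sₖ` valid on `S` holds weakly at `g`
(`geometric_hahn_banach_point_closed` in the locally convex space `ℝ^ι`). [folklore] -/
theorem mem_closure_convexHull {ι : Type*} [Fintype ι] {S : Set (ι → ℝ)} {g : ι → ℝ}
    (h : ∀ (c : ι → ℝ) (u : ℝ), (∀ s ∈ S, u < ∑ k, c k * s k) → u ≤ ∑ k, c k * g k) :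
    g ∈ closure (convexHull ℝ S) := by
  by_contra hnot
  obtain ⟨f, u, hfu, hub⟩ := geometric_hahn_banach_point_closed
    (convex_convexHull ℝ S).closure isClosed_closure hnot
  obtain ⟨c, hc⟩ := exists_coeffs f
  have key := h c u fun s hs => by
    rw [← hc]
    exact hub s (subset_closure (subset_convexHull ℝ S hs))
  rw [← hc] at key
  exact absurd hfu (not_lt.2 key)

/-- A point of the closed convex hull of an image `Φ '' K ⊆ ℝ^ι` is, coordinatewise up to any
`ε > 0`, a finite convex combination `∑ⱼ wⱼ Φ(zⱼ)` with `zⱼ ∈ K` (`Metric.mem_closure_iff`,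
`mem_convexHull_iff_exists_fintype`, sup-norm bound `dist_le_pi_dist`). [folklore] -/
theorem exists_convexCombination {ι : Type*} [Fintype ι] {X : Type*} {K : Set X}
    {Φ : X → ι → ℝ} {g : ι → ℝ} (hg : g ∈ closure (convexHull ℝ (Φ '' K))) {ε : ℝ}
    (hε : 0 < ε) :
    ∃ (κ : Type) (_ : Fintype κ) (w : κ → ℝ) (z : κ → X), (∀ j, 0 ≤ w j) ∧ ∑ j, w j = 1 ∧
      (∀ j, z j ∈ K) ∧ ∀ k, |g k - ∑ j, w j * Φ (z j) k| < ε := by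
  obtain ⟨p, hp, hgp⟩ := Metric.mem_closure_iff.1 hg ε hε
  obtain ⟨κ, _, w, z', hw0, hw1, hz', hsum⟩ := mem_convexHull_iff_exists_fintype.1 hp
  choose z hzK hz using hz'
  refine ⟨κ, inferInstance, w, z, hw0, hw1, hzK, fun k => ?_⟩
  have hpk : p k = ∑ j, w j * Φ (z j) k := by
    rw [← hsum, Finset.sum_apply]
    exact Finset.sum_congr rfl fun j _ => by rw [Pi.smul_apply, smul_eq_mul, hz]
  rw [← hpk, ← Real.dist_eq]
  exact (dist_le_pi_dist g p k).trans_lt hgp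

/-- The discrete measure `∑ⱼ wⱼ δ_{zⱼ}` of a finite convex combination of points of the closed
cube `[0,1]³` is a probability measure, gives no mass to the complement of the cube, and
integrates every function to the corresponding convex combination of its values
(`integral_finsetSum_measure`, `integral_smul_measure`, `integral_dirac`). [folklore] -/
theorem discreteMeasure {κ : Type*} [Fintype κ] (w : κ → ℝ) (hw0 : ∀ j, 0 ≤ w j)
    (hw1 : ∑ j, w j = 1) (z : κ → (Fin 3 → ℝ)) (hz : ∀ j i, 0 ≤ z j i ∧ z j i ≤ 1) :
    IsProbabilityMeasure (∑ j, ENNReal.ofReal (w j) • Measure.dirac (z j)) ∧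
      (∑ j, ENNReal.ofReal (w j) • Measure.dirac (z j)) {t | ∃ i, t i < 0 ∨ 1 < t i} = 0 ∧
      ∀ f : (Fin 3 → ℝ) → ℝ,
        ∫ t, f t ∂(∑ j, ENNReal.ofReal (w j) • Measure.dirac (z j)) = ∑ j, w j * f (z j) := by
  refine ⟨⟨?_⟩, ?_, fun f => ?_⟩
  · rw [Measure.finsetSum_apply]
    simp_rw [Measure.smul_apply, measure_univ, smul_eq_mul, mul_one]
    rw [← ENNReal.ofReal_sum_of_nonneg fun j _ => hw0 j, hw1, ENNReal.ofReal_one]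
  · rw [Measure.finsetSum_apply]
    refine Finset.sum_eq_zero fun j _ => ?_
    rw [Measure.smul_apply, Measure.dirac_apply, Set.indicator_of_notMem, smul_zero]
    rintro ⟨i, hi | hi⟩
    · exact absurd hi (not_lt.2 (hz j i).1)
    · exact absurd hi (not_lt.2 (hz j i).2)
  · rw [integral_finsetSum_measure fun j _ =>
      (integrable_dirac enorm_lt_top).smul_measure ENNReal.ofReal_ne_top]
    refine Finset.sum_congr rfl fun j _ => ?_
    rw [integral_smul_measure, integral_dirac, ENNReal.toReal_ofReal (hw0 j), smul_eq_mul]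

/-- Steps 2–3 of the proof: a point of the closed convex hull of the kernel vectors
`(∏ᵢ tᵢ^{x_{k,i}²})ₖ`, `t ∈ [0,1]³`, is matched up to `ε` by the kernel moments of a probability
measure carried by the closed cube (a finite convex combination of Dirac masses). [folklore] -/
theorem exists_measure_of_mem_closure {m : ℕ} (x : Fin m → Site 3) {g : Fin m → ℝ}
    (hg : g ∈ closure (convexHull ℝ
      ((fun (t : Fin 3 → ℝ) (k : Fin m) => ∏ i, (t i) ^ ((x k i).natAbs ^ 2)) ''
        {t | ∀ i, 0 ≤ t i ∧ t i ≤ 1})))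
    {ε : ℝ} (hε : 0 < ε) :
    ∃ μ : Measure (Fin 3 → ℝ), IsProbabilityMeasure μ ∧ μ {t | ∃ i, t i < 0 ∨ 1 < t i} = 0 ∧
      ∀ k, |g k - ∫ t, ∏ i, (t i) ^ ((x k i).natAbs ^ 2) ∂μ| < ε := by
  obtain ⟨κ, _, w, z, hw0, hw1, hzK, happrox⟩ := exists_convexCombination hg hε
  obtain ⟨hprob, hnull, hint⟩ := discreteMeasure w hw0 hw1 z fun j => hzK j
  refine ⟨_, hprob, hnull, fun k => ?_⟩
  rw [hint fun t => ∏ i, (t i) ^ ((x k i).natAbs ^ 2)]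
  exact happrox k

/-- Step 1 of the proof: under the dual-cone inequalities (and `G 0 = 1`) the data vector
`(G xₖ)ₖ` lies in the closed convex hull of the kernel vectors `(∏ᵢ tᵢ^{x_{k,i}²})ₖ`, `t ∈ [0,1]³`.
Separation (`mem_closure_convexHull`) plus the site `0`, whose kernel is the constant `1`, used to
absorb the level of the separating hyperplane. [folklore] -/
theorem mem_closure_of_dualCone (G : Site 3 → ℝ) (hG0 : G 0 = 1)
    (hdual : ∀ (m : ℕ) (c : Fin m → ℝ) (x : Fin m → Site 3),
      (∀ t : Fin 3 → ℝ, (∀ i, 0 ≤ t i ∧ t i ≤ 1) →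
        0 ≤ ∑ k, c k * ∏ i, (t i) ^ ((x k i).natAbs ^ 2)) →
      0 ≤ ∑ k, c k * G (x k))
    (m : ℕ) (x : Fin m → Site 3) :
    (fun k => G (x k)) ∈ closure (convexHull ℝ
      ((fun (t : Fin 3 → ℝ) (k : Fin m) => ∏ i, (t i) ^ ((x k i).natAbs ^ 2)) ''
        {t | ∀ i, 0 ≤ t i ∧ t i ≤ 1})) := by
  refine mem_closure_convexHull fun c u hcu => ?_
  -- the dual-cone inequality for the family `(0, x)` with coefficients `(-u, c)`
  have key := hdual (m + 1) (Fin.cons (-u) c) (Fin.cons 0 x) fun t ht => by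
    have h := hcu _ ⟨t, ht, rfl⟩
    rw [Fin.sum_univ_succ]
    simp only [Fin.cons_zero, Fin.cons_succ, Pi.zero_apply, Int.natAbs_zero, ne_eq,
      OfNat.ofNat_ne_zero, not_false_eq_true, zero_pow, pow_zero, Finset.prod_const_one, mul_one]
    linarith
  rw [Fin.sum_univ_succ] at key
  simp only [Fin.cons_zero, Fin.cons_succ, hG0, mul_one] at key
  linarith

end CriticalTwoPointGSMDualCone

open CriticalTwoPointGSMDualCone in
/-- **Dual-cone inequalities ⇒ approximate cube representations (finite-family step).** If
`G 0 = 1` and `G : ℤ³ → ℝ` satisfies the dual-cone inequalities of the closed Gaussian-scale-mixture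
cone — every finite combination `∑ₖ cₖ ∏ᵢ tᵢ^{x_{k,i}²}` of the polynomial kernels that is
non-negative on the cube `[0,1]³` gives `∑ₖ cₖ G(xₖ) ≥ 0` — then on every finite family of sites
`G` is matched up to any `ε > 0` by the kernel moments `∫ ∏ᵢ tᵢ^{x_{k,i}²} dμ` of a probability
measure `μ` on `ℝ³` giving no mass to the complement of the closed cube. (Minkowski separation in
`ℝ^m`; the Hahn–Banach half of "cube representation ⇔ dual cone".) [folklore] -/
theorem cubeRepApprox_of_dualCone (G : Site 3 → ℝ) (hG0 : G 0 = 1)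
    (hdual : ∀ (m : ℕ) (c : Fin m → ℝ) (x : Fin m → Site 3),
      (∀ t : Fin 3 → ℝ, (∀ i, 0 ≤ t i ∧ t i ≤ 1) →
        0 ≤ ∑ k, c k * ∏ i, (t i) ^ ((x k i).natAbs ^ 2)) →
      0 ≤ ∑ k, c k * G (x k))
    (m : ℕ) (x : Fin m → Site 3) {ε : ℝ} (hε : 0 < ε) :
    ∃ μ : Measure (Fin 3 → ℝ), IsProbabilityMeasure μ ∧ μ {t | ∃ i, t i < 0 ∨ 1 < t i} = 0 ∧
      ∀ k, |G (x k) - ∫ t, ∏ i, (t i) ^ ((x k i).natAbs ^ 2) ∂μ| < ε :=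
  exists_measure_of_mem_closure x (mem_closure_of_dualCone G hG0 hdual m x) hε

end Summit.CriticalPhenomena.Ising3DConformalLimit.Theorems
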